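import Literature.AlgebraicGeometry.Resolution.BlowupStrictTransform
import Literature.AlgebraicGeometry.Resolution.AffineBlowupAlgebra
import Literature.AlgebraicGeometry.Resolution.QuasiRegularSequences
import HarnessLib

/-!
# `EquisingularLift`, line `Sketch` v7 — stub `stub_blowupChart_specialFibre`

Crux `stmt-ResolutionOfSingularities-15660` = `Theses.EquisingularLift.EquisingularLift`; registered move-set stub #7 of
the skeleton `Cruxes/EquisingularLift/Lines/Sketch.lean` (v7, lead `res-L1-w45b-lead-1`, 2026-08-26): **the special
fibre of a blow-up chart along a HORIZONTAL centre is the blow-up chart of the special fibre.**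

Setting: `R` any commutative ring, `ϖ ∈ R` (the uniformizer), `x : ι → R` a quasi-regular family generating
`I = (x)`, with `(I : ϖ) = I` (`ϖ` is a non-zero-divisor modulo `I`). Write `q : R → R/ϖ`, `Ī = I·(R/ϖ)`,
`a = xᵢ`, and `φ = q[1/a] : R[1/a] → (R/ϖ)[1/ā]`. CLAIM:

1. `φ(R[I/a]) = (R/ϖ)[Ī/ā]` — the chart ring `R[I/a] ⊆ R[1/a]` of `Bl_I Spec R` (the tree's image model
   `blowupAlgebra`, Stacks 052Q / 07Z3) maps ONTO the chart ring of the blow-up of the special fibre along `Ī`: true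
   for any `I, ϖ`, since generators go to generators and `q` is onto (`awayMap_mem_blowupAlgebra`,
   `blowupAlgebraMap_surjective`, Görtz–Wedhorn Prop. 13.96 (2));
2. `ker (φ|_{R[I/a]}) = ϖ · R[I/a]` — if `b = r/aⁿ ∈ R[I/a]` (`r ∈ Iⁿ`, `exists_eq_mul_invSelf_pow_of_mem_blowupAlgebra`)
   has `φ(b) = 0`, then `āᵏ·q(r) = 0` in `R/ϖ` for some `k`, i.e. `aᵏ r = ϖ w`; as `aᵏ r ∈ I^{k+n}` and
   `(I^ν : ϖ) = I^ν` for all `ν` (Matsumura 16.2 (ii), `IsQuasiRegular.mem_pow_of_mul_mem_pow`), `w ∈ I^{k+n}`, so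
   `b = aᵏ r / a^{k+n} = ϖ · (w / a^{k+n})` with `w / a^{k+n} ∈ R[I/a]`.

Together: `R[I/a] / ϖ ≅ (R/ϖ)[Ī/ā]`, i.e. **the special fibre of the blow-up is the blow-up of the special fibre**
(Stacks 0805 for the `O`-flat exceptional data; the section case is what the line's section blow-up files compute).

References: H. Matsumura, *Commutative Ring Theory*, CUP 1986, Thm. 16.2 (ii); The Stacks Project, Tags 052Q, 07Z3,
0805; U. Görtz, T. Wedhorn, *Algebraic Geometry I*, 2nd ed. 2020, (13.19), Prop. 13.96 (2).
-/

set_option linter.dupNamespace false -- mandated namespace `Summit.<Summit>.<Problem>` of this single-conjunct summit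

noncomputable section

open Polynomial IsLocalization
open Literature.AlgebraicGeometry.Resolution

namespace Summit.ResolutionOfSingularities.ResolutionOfSingularities.Cruxes.EquisingularLift.StrataSplit

universe u

/-! ## Elements of the affine blowup algebra are fractions `r/aⁿ`, `r ∈ Iⁿ` -/

/-- **Stacks 052Q**: for `a ∈ I`, every element of the affine blowup algebra `R[I/a] ⊆ R[1/a]` is "represented by an
expression of the form `r/aⁿ` with `r ∈ Iⁿ`" (read off the chart isomorphism `(R[It])_{(at)} ≅ R[I/a]`,
`range_reesChart` / `reesChart_mk`). [cite: StacksProject, Tag 052Q] -/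
theorem exists_eq_mul_invSelf_pow_of_mem_blowupAlgebra {R : Type u} [CommRing R] {I : Ideal R} {a : R}
    (ha : a ∈ I) {z : Localization.Away a} (hz : z ∈ blowupAlgebra I a) :
    ∃ (n : ℕ) (r : R), r ∈ I ^ n ∧
      z = algebraMap R (Localization.Away a) r * IsLocalization.Away.invSelf a ^ n := by
  -- adapted from Literature.AlgebraicGeometry.Resolution.range_reesChart (first half)
  have hz' : z ∈ Set.range (reesChart a ha) := by
    rw [range_reesChart a ha]; exact hz
  obtain ⟨y, rfl⟩ := hz'
  obtain ⟨n, x, hx, rfl⟩ :=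
    HomogeneousLocalization.Away.mk_surjective (reesGrading I) (reesT_mem a ha) y
  obtain ⟨r, hr⟩ := (mem_reesGrading_iff I).mp hx
  have hn : (n • 1 : ℕ) = n := by simp
  have hr' : (x : R[X]) = monomial n r := by rw [← hr, hn]
  have hrI : r ∈ I ^ n := by
    have := x.2
    rw [hr', reesAlgebra.monomial_mem] at this
    exact this
  exact ⟨n, r, hrI, reesChart_mk a ha hx hr'⟩

/-! ## The registered stub -/

/-- **STUB `stub_blowupChart_specialFibre`** (move 7 of the line `Sketch` v7: the special fibre of a blow-up chart
along a HORIZONTAL centre). `R` any ring, `ϖ ∈ R`, `x : ι → R` quasi-regular generating `I`, `(I : ϖ) = I`. Then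
reduction modulo `ϖ`, `R[1/xᵢ] → (R/ϖ)[1/x̄ᵢ]`, maps the chart ring `R[I/xᵢ]` of `Bl_I Spec R` ONTO the chart ring
`(R/ϖ)[Ī/x̄ᵢ]` of the blow-up of the special fibre along `Ī = I·(R/ϖ)` (conjunct 1, any `I, ϖ`), with kernel
`ϖ·R[I/xᵢ]` (conjunct 2: `b = r/xᵢⁿ`, `x̄ᵢᵏ q(r) = 0` gives `xᵢᵏ r = ϖ w` with `w ∈ I^{k+n}` by Matsumura 16.2 (ii),
so `b = ϖ · w/xᵢ^{k+n}`). [cite: Matsumura1987, Thm. 16.2 (ii); StacksProject, Tag 0805] -/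
theorem stub_blowupChart_specialFibre : ∀ (R : Type) [CommRing R] (ι : Type) (x : ι → R) (i : ι) (ϖ : R), Literature.AlgebraicGeometry.Resolution.IsQuasiRegular x → (∀ y, ϖ * y ∈ Ideal.span (Set.range x) → y ∈ Ideal.span (Set.range x)) → (IsLocalization.Away.map (Localization.Away (x i)) (Localization.Away ((Ideal.Quotient.mk (Ideal.span {ϖ})) (x i))) (Ideal.Quotient.mk (Ideal.span {ϖ})) (x i)) '' (Literature.AlgebraicGeometry.Resolution.blowupAlgebra (Ideal.span (Set.range x)) (x i) : Set (Localization.Away (x i))) = (Literature.AlgebraicGeometry.Resolution.blowupAlgebra (Ideal.map (Ideal.Quotient.mk (Ideal.span {ϖ})) (Ideal.span (Set.range x))) ((Ideal.Quotient.mk (Ideal.span {ϖ})) (x i)) : Set (Localization.Away ((Ideal.Quotient.mk (Ideal.span {ϖ})) (x i)))) ∧ ∀ b ∈ Literature.AlgebraicGeometry.Resolution.blowupAlgebra (Ideal.span (Set.range x)) (x i), IsLocalization.Away.map (Localization.Away (x i)) (Localization.Away ((Ideal.Quotient.mk (Ideal.span {ϖ})) (x i))) (Ideal.Quotient.mk (Ideal.span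 {ϖ})) (x i) b = 0 → ∃ c ∈ Literature.AlgebraicGeometry.Resolution.blowupAlgebra (Ideal.span (Set.range x)) (x i), b = algebraMap R (Localization.Away (x i)) ϖ * c := by
  intro R _ ι x i ϖ hx hϖ
  set I : Ideal R := Ideal.span (Set.range x) with hI
  set q : R →+* R ⧸ Ideal.span {ϖ} := Ideal.Quotient.mk (Ideal.span {ϖ}) with hq
  set a : R := x i with ha
  have haI : a ∈ I := Ideal.subset_span ⟨i, rfl⟩
  refine ⟨?_, ?_⟩
  · -- conjunct 1: the image of `R[I/a]` is `(R/ϖ)[Ī/ā]`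
    apply Set.Subset.antisymm
    · rintro _ ⟨z, hz, rfl⟩
      exact awayMap_mem_blowupAlgebra q I (I.map q) a le_rfl hz
    · intro z hz
      obtain ⟨⟨v, hv⟩, hvz⟩ :=
        blowupAlgebraMap_surjective q I (I.map q) a Ideal.Quotient.mk_surjective le_rfl le_rfl ⟨z, hz⟩
      exact ⟨v, hv, congrArg Subtype.val hvz⟩
  · -- conjunct 2: the kernel is `ϖ · R[I/a]`
    intro b hb h0
    obtain ⟨n, r, hr, rfl⟩ := exists_eq_mul_invSelf_pow_of_mem_blowupAlgebra haI hb
    -- `q(r)/1 = 0` in `(R/ϖ)[1/ā]`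
    have h0' : Localization.awayMap q a
        (algebraMap R (Localization.Away a) r * IsLocalization.Away.invSelf a ^ n) = 0 := h0
    rw [map_mul, map_pow, awayMap_algebraMap, awayMap_invSelf] at h0'
    have hinv : IsLocalization.Away.invSelf (S := Localization.Away (q a)) (q a) ^ n *
        algebraMap (R ⧸ Ideal.span {ϖ}) (Localization.Away (q a)) (q a) ^ n = 1 := by
      rw [← mul_pow, mul_comm, IsLocalization.Away.mul_invSelf, one_pow]
    have h1 : algebraMap (R ⧸ Ideal.span {ϖ}) (Localization.Away (q a)) (q r) = 0 := by
      calc algebraMap (R ⧸ Ideal.span {ϖ}) (Localization.Away (q a)) (q r)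
          = algebraMap _ _ (q r) * (IsLocalization.Away.invSelf (S := Localization.Away (q a)) (q a) ^ n *
              algebraMap _ (Localization.Away (q a)) (q a) ^ n) := by rw [hinv, mul_one]
        _ = (algebraMap _ _ (q r) * IsLocalization.Away.invSelf (S := Localization.Away (q a)) (q a) ^ n) *
              algebraMap _ (Localization.Away (q a)) (q a) ^ n := by rw [mul_assoc]
        _ = 0 := by rw [h0', zero_mul]
    -- hence `āᵏ · q(r) = 0` in `R/ϖ`, i.e. `aᵏ r = ϖ w`
    obtain ⟨⟨m, hm⟩, hm0⟩ :=
      (IsLocalization.map_eq_zero_iff (Submonoid.powers (q a)) (Localization.Away (q a)) (q r)).mp h1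
    obtain ⟨k, rfl⟩ := (Submonoid.mem_powers_iff _ _).mp hm
    have hmem : a ^ k * r ∈ Ideal.span {ϖ} := by
      rw [← Ideal.Quotient.eq_zero_iff_mem, ← hq, map_mul, map_pow]
      exact hm0
    obtain ⟨w, hw⟩ := Ideal.mem_span_singleton'.mp hmem
    -- `aᵏ r ∈ I^{k+n}`, so `w ∈ I^{k+n}` by Matsumura 16.2 (ii)
    have hakr : a ^ k * r ∈ I ^ (k + n) := by
      rw [pow_add]
      exact Ideal.mul_mem_mul (Ideal.pow_mem_pow haI k) hr
    have hwI : w ∈ I ^ (k + n) := by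
      refine hx.mem_pow_of_mul_mem_pow hϖ (k + n) ?_
      rw [mul_comm, hw]
      exact hakr
    -- `b = ϖ · (w / a^{k+n})`
    have hone : algebraMap R (Localization.Away a) a ^ k * IsLocalization.Away.invSelf a ^ k = 1 := by
      rw [← mul_pow, IsLocalization.Away.mul_invSelf, one_pow]
    refine ⟨_, algebraMap_mul_invSelf_pow_mem_blowupAlgebra a (k + n) hwI, ?_⟩
    calc algebraMap R (Localization.Away a) r * IsLocalization.Away.invSelf a ^ n
        = algebraMap R _ r * (algebraMap R (Localization.Away a) a ^ k * IsLocalization.Away.invSelf a ^ k) *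
            IsLocalization.Away.invSelf a ^ n := by rw [hone, mul_one]
      _ = algebraMap R _ (a ^ k * r) * IsLocalization.Away.invSelf a ^ (k + n) := by
            rw [map_mul, map_pow, pow_add]; ring
      _ = algebraMap R _ (w * ϖ) * IsLocalization.Away.invSelf a ^ (k + n) := by rw [hw]
      _ = algebraMap R (Localization.Away a) ϖ *
            (algebraMap R _ w * IsLocalization.Away.invSelf a ^ (k + n)) := by
            rw [map_mul]; ring

end Summit.ResolutionOfSingularities.ResolutionOfSingularities.Cruxes.EquisingularLift.StrataSplit

end
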